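import Summits.KontsevichZagierPeriods.KontsevichZagierPeriods.Theorems.HurwitzMicroSectorsNormalFormPrincipleM2FiveZetaTwo
import Literature.NumberTheory.Transcendental.EllIterRep

/-!
# `NormalFormPrinciple` (stmt-KontsevichZagierPeriods-3869), line `SketchIdeator1` — leaf `stub_boxRigidity`,
# dimension two off the product type (`CatalanTwoWays`, disc side): existence of unfolded log monomials over `(lo, hi)`

Pure proof file (stub `exists_logMonomialRep_Ioo`; `--supports` the crux): the generalisation of
`exists_logMonomialRep` (base interval `(0,1)`) to an arbitrary open base interval `(lo, hi)` with
REAL-ALGEBRAIC endpoints. For `g, v : ℝ → ℝ` such that `y ↦ g (y 0)` and `y ↦ v (y 0)` are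
`ℚ`-semialgebraic on `σ' = {lo < y 0 < hi} ⊆ ℝ¹`, `v ≥ 1` on `(lo, hi)` and `g · log v`
absolutely integrable on `(lo, hi)`, the "log monomial"
`M(g, v) = [{(x, s) | lo < x < hi, 1 ≤ s ≤ v x}, g(x)/s]` is an integral representation of
dimension `2` (`KZ.IntegralRep 2`), with domain the band `KZlog.band σ' 1 (v ∘ ·0)` and integrand
`z ↦ g (z 0) / z 1` (literal equalities).

Proof: `σ' = {lo < y 0} ∩ {y 0 < hi}` is `ℚ`-semialgebraic since real algebraic constants are
`ℚ`-definable (`KZ.isSemialgebraic_setOf_const_lt_apply`, `KZ.isSemialgebraic_setOf_apply_lt_const`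
of `EllIterRep`); the one-variable integrability hypothesis is transported to `ℝ¹ = (Fin 1 → ℝ)`
along the measure-preserving equivalence `MeasurableEquiv.funUnique`; this makes `[σ'; 0; (g, v)]`
an admissible logarithmic term (`KZlog.Term.Admissible`), and the representation sought is the
unfolding `KZlog.IntegralRep.monomialRep` of its single monomial ("introducing more variables":
`log v = ∫₁^v ds/s`), whose domain and integrand are the required ones by `rfl`.

References: M. Kontsevich, D. Zagier, *Periods* (2001), §1.1–§1.2. No new definitions.
-/

noncomputable section

open MeasureTheory Set
open Literature.NumberTheory.Transcendental Literature.NumberTheory.Transcendental.KZ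
open Literature.ModelTheory.ExponentialFields (IsSemialgebraic)

namespace Summit.KontsevichZagierPeriods.HurwitzMicroSectors.NormalFormPrinciple.PiBox.M2

/-- Transport of integrability from `(lo, hi) ⊆ ℝ` to `σ' = {lo < x 0 < hi} ⊆ ℝ¹` along the
measure-preserving equivalence `ℝ¹ ≃ ℝ`. [folklore] -/
theorem integrableOn_fin_one_Ioo_of_integrableOn {lo hi : ℝ} {f : ℝ → ℝ}
    (hf : IntegrableOn f (Set.Ioo lo hi)) :
    IntegrableOn (fun x : Fin 1 → ℝ => f (x 0)) {x : Fin 1 → ℝ | lo < x 0 ∧ x 0 < hi} := by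
  have hmp := MeasureTheory.volume_preserving_funUnique (Fin 1) ℝ
  have hpre : {x : Fin 1 → ℝ | lo < x 0 ∧ x 0 < hi} =
      MeasurableEquiv.funUnique (Fin 1) ℝ ⁻¹' Ioo lo hi := by
    ext x
    simp [MeasurableEquiv.funUnique, Fin.default_eq_zero]
  rw [hpre]
  exact (hmp.integrableOn_comp_preimage (MeasurableEquiv.measurableEmbedding _)).mpr hf

/-- **Admissibility of the one-monomial logarithmic term `[σ'; 0; (g, v)]` over the base
`σ' = {lo < x 0 < hi}`** (`lo`, `hi` real algebraic): `σ' = {lo < x 0} ∩ {x 0 < hi}` is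
`ℚ`-semialgebraic (real algebraic constants are `ℚ`-definable), `0`, `g`, `v` are
`ℚ`-semialgebraic on `σ'`, `v ≥ 1` on `σ'`, and `g log v` is absolutely integrable on `σ'`
(transported from `(lo, hi)`). [Kontsevich–Zagier 2001, §1.1 ("rational" may be replaced by
"algebraic")] [folklore] -/
theorem admissible_logTerm_Ioo (lo hi : ℝ) (hlo : IsAlgebraic ℚ lo) (hhi : IsAlgebraic ℚ hi)
    (g v : ℝ → ℝ)
    (hg : IsSemialgebraicFunOn ℚ {y : Fin 1 → ℝ | lo < y 0 ∧ y 0 < hi} (fun y => g (y 0)))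
    (hv : IsSemialgebraicFunOn ℚ {y : Fin 1 → ℝ | lo < y 0 ∧ y 0 < hi} (fun y => v (y 0)))
    (hv1 : ∀ x ∈ Set.Ioo lo hi, 1 ≤ v x)
    (hint : IntegrableOn (fun x => g x * Real.log (v x)) (Set.Ioo lo hi)) :
    KZlog.Term.Admissible
      ⟨{y : Fin 1 → ℝ | lo < y 0 ∧ y 0 < hi}, 0, 1, fun _ y => g (y 0), fun _ y => v (y 0)⟩ :=
  have hσ : IsSemialgebraic ℚ {y : Fin 1 → ℝ | lo < y 0 ∧ y 0 < hi} :=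
    (isSemialgebraic_setOf_const_lt_apply hlo 0).inter (isSemialgebraic_setOf_apply_lt_const hhi 0)
  { isSemialgebraic_domain := hσ
    isSemialgebraicFunOn_h₀ := (isSemialgebraicFunOn_ratCast hσ 0).congr fun x _ => by simp
    integrableOn_h₀ := integrableOn_zero
    isSemialgebraicFunOn_h := fun _ => hg
    isSemialgebraicFunOn_v := fun _ => hv
    one_le_v := fun _ y hy => hv1 (y 0) hy
    integrableOn_monomial := fun _ =>
      integrableOn_fin_one_Ioo_of_integrableOn (f := fun x => g x * Real.log (v x)) hint }

/-- **Stub (existence of unfolded log monomials over `(lo, hi)`, real-algebraic endpoints).** For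
`g`, `v` `ℚ`-semialgebraic on `(lo, hi)` with `v ≥ 1` and `g log v` absolutely integrable on
`(lo, hi)`, the unfolded monomial `M(g, v) = [{lo < x < hi, 1 ≤ s ≤ v x}, g(x)/s]` is an integral
representation of dimension `2`: the unfolding `KZlog.IntegralRep.monomialRep` of the admissible
term `[σ'; 0; (g, v)]` ("introducing more variables", `log v = ∫₁^v ds/s`).
[Kontsevich–Zagier 2001, §1.1–§1.2] [folklore] -/
theorem exists_logMonomialRep_Ioo (lo hi : ℝ) (hlo : IsAlgebraic ℚ lo) (hhi : IsAlgebraic ℚ hi)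
    (g v : ℝ → ℝ)
    (hg : IsSemialgebraicFunOn ℚ {y : Fin 1 → ℝ | lo < y 0 ∧ y 0 < hi} (fun y => g (y 0)))
    (hv : IsSemialgebraicFunOn ℚ {y : Fin 1 → ℝ | lo < y 0 ∧ y 0 < hi} (fun y => v (y 0)))
    (hv1 : ∀ x ∈ Set.Ioo lo hi, 1 ≤ v x)
    (hint : IntegrableOn (fun x => g x * Real.log (v x)) (Set.Ioo lo hi)) :
    ∃ R : IntegralRep 2,
      R.domain = KZlog.band {y : Fin 1 → ℝ | lo < y 0 ∧ y 0 < hi} (fun _ => (1:ℝ)) (fun y => v (y 0)) ∧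
      R.integrand = fun z => g (z 0) / z 1 :=
  ⟨KZlog.IntegralRep.monomialRep ⟨_, admissible_logTerm_Ioo lo hi hlo hhi g v hg hv hv1 hint⟩ 0,
    rfl, rfl⟩

end Summit.KontsevichZagierPeriods.HurwitzMicroSectors.NormalFormPrinciple.PiBox.M2
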